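import Summits.QuantumFields.YangMills.Theorems.PoincareLipschitzSamplingCells
import HarnessLib


/-!
# Crux `HistoryTailL` (stmt-QuantumFields-19936), K2 organ `hImproveCoreFlat`, road R1 (LINE 25 `CompactnessTransfer`, stub S2) — FILE B3-b
# «SAMPLING CONSISTENCY FROM ABOVE»: the lattice Dirichlet energy of the scale-`R` SAMPLE of a `C¹` map on the unit cube of `ℝ³` is at most the
# continuum Dirichlet energy on a slightly larger cube plus `η`, for `R ≥ R₀(V, η)` — the continuum → lattice direction, with the `IntegrableOn`
# hypothesis (no Bochner vacuity)

Cell `ym3-torus` (YM ladder rung R3 = continuum SU(2) Yang–Mills on T³ — a RUNG, NOT the Clay problem: not d = 4, not infinite volume, not a mass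
gap); TWIN-WIDTH helper seat `ym-ust-19936-w7` g13 (LEAD ★w1-19936 g9 10:49:08Z «B3-b GO»).  Helper `--supports stmt-QuantumFields-19936`; THEOREMS
ONLY (0 `def`, 0 `sorry`, default heartbeats); Mathlib + lit ✓`B4Eq19LatticeOperators` (`Zd 3`, `box`, `unitVec`).

WHY.  S2 `stub_latticeToContinuumLimit` of LINE 25 ends with «lattice energies converge FROM ABOVE at comparable scales»: the recovery sequence for a
continuum competitor `V` is its lattice SAMPLE `v y := V(y∕R)` glued to the almost-minimiser by ✓H-3∕H-4 (`exists_unit_interpolant` ∕ `exists_unit_glue_annulus`);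
this file bounds the sample's lattice energy by the continuum energy (px7 g7's B3-a Kuhn interpolant is the opposite direction, lattice → continuum).
The density is LINE 25's own expression `Σᵢ ‖fderiv ℝ V x (EuclideanSpace.single i 1)‖²` (a32df1fa :84), and its `IntegrableOn` on the larger cube
is a HYPOTHESIS (after LEAD's ¬S1 ✓: Bochner integrals of non-integrable densities vanish).  The sampling map is carried as a variable `P : Zd 3 → ℝ³`
with its defining row `P y i = y i ∕ R` (consumers instantiate it by `rfl`-class proofs).

THE ARGUMENT.  Uniform continuity of `fderiv ℝ V` on the compact cube `{|xᵢ| ≤ s′}` (modulus `δ(ω)`); for `R ≥ R₀` every open grid cell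
`c_y = Π (yᵢ∕R, (yᵢ+1)∕R)`, `y ∈ Q_{⌊sR⌋}(0)`, lies in `{|xᵢ| < s′}` and has diameter `< δ`; the mean value inequality with the frozen derivative
`fderiv ℝ V x₀` (`x₀ ∈ c_y`) along the bond segment (an edge of the closed cell) gives `‖V(P(y+e_μ)) − V(P y)‖ ≤ R⁻¹(‖fderiv V x₀ e_μ‖ + ω)`, whence
`R²·Σ_μ‖δ_μ v(y)‖² ≤ (1+θ)·density(x₀) + 3(1+θ⁻¹)ω²` for EVERY `x₀ ∈ c_y`; integrating over `c_y` (volume `R⁻³`) and summing over the pairwise disjoint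
cells inside `{|xᵢ| < s′}`: `R⁻¹·E_latt ≤ (1+θ)·∫ density + 3(1+θ⁻¹)ω²(2s′)³ ≤ ∫ density + η` for `θ = η∕(2(I+1))`, `ω` small.

WHAT IS PROVED (ns `…Theorems.PoincareLipschitzSamplingConsistency`; letters in ✓B3-b1 `…PoincareLipschitzSamplingCells`).
* ★★★ `lattice_energy_sample_le` — B3-b as displayed in the title (decl-local `maxHeartbeats 400000`: the one-piece ε-bookkeeping proof exceeds the
  100k scratch budget at `whnf`, passes at the farm default; RULING №24 (d), unworded class).
HONEST SCOPE.  One lattice∕measure brick of road R1's S2; S1′∕S2, `hImproveCoreFlat`, K1, `MeanDeviationL`, `BlockLipschitzL`, `HistoryTailL` are NOT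
proved here.  YM₃ on T³ is rung R3, not Clay; YM gap NOT proved; no summit statement is proved here.

References: S. Luckhaus, Indiana Univ. Math. J. 37 (1988) 349–367 (Thm 2, recovery sequences); R. Alicandro, M. Cicalese, SIAM J. Math. Anal. 2008
(Γ-limits of `S^k`-spin lattice energies) [AlicandroCicalese2008]; L. Simon, Theorems on Regularity and Singularity of Energy Minimizing Maps (1996) §2.9.
-/

set_option autoImplicit false

noncomputable section

open scoped BigOperators
open MeasureTheory Set Finset Metric

namespace Summit.QuantumFields.YangMills.Theorems.PoincareLipschitzSamplingConsistency

open Literature.MathematicalPhysics.QuantumFieldTheory.Balaban1983to89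
open B4Eq19LatticeOperators (Zd box unitVec mem_box)
open Summit.QuantumFields.YangMills.Theorems.PoincareLipschitzSamplingCells

/-! ## §3 ★★★ B3-b: the lattice energy of the sample is at most the continuum energy `+ η` -/

set_option maxHeartbeats 400000 in
/-- ★★★ **B3-b — SAMPLING CONSISTENCY FROM ABOVE.**  Let `V : ℝ³ → ℝ⁴` be `C¹` on the open unit cube `{|xᵢ| < 1}`, `0 < s < s′ < 1`, and let the
density `Σᵢ ‖fderiv ℝ V x eᵢ‖²` be integrable on `{|xᵢ| < s′}`.  Then for every `η > 0` there is `R₀` such that for all `R ≥ R₀` and every sampling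
map `P` with `P y i = y i ∕ R`:
`R⁻¹ · Σ_{y ∈ Q_{⌊sR⌋}(0)} Σ_μ ‖V(P(y + e_μ)) − V(P y)‖² ≤ ∫_{|xᵢ| < s′} Σᵢ ‖fderiv ℝ V x eᵢ‖² dx + η`.
[cite: AlicandroCicalese2008, Thm 4.1] -/
theorem lattice_energy_sample_le
    (V : EuclideanSpace ℝ (Fin 3) → EuclideanSpace ℝ (Fin 4))
    (hV : ContDiffOn ℝ 1 V {x : EuclideanSpace ℝ (Fin 3) | ∀ i : Fin 3, |x i| < 1})
    {s s' : ℝ} (hs : 0 < s) (hss' : s < s') (hs'1 : s' < 1)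
    (hint : IntegrableOn (fun x => ∑ i : Fin 3, ‖fderiv ℝ V x (EuclideanSpace.single i (1:ℝ))‖ ^ 2)
      {x : EuclideanSpace ℝ (Fin 3) | ∀ i : Fin 3, |x i| < s'} volume)
    {η : ℝ} (hη : 0 < η) :
    ∃ R₀ : ℕ, ∀ R : ℕ, R₀ ≤ R → ∀ (P : Zd 3 → EuclideanSpace ℝ (Fin 3)), (∀ (y : Zd 3) (i : Fin 3), P y i = (y i : ℝ) / R) →
      (R : ℝ)⁻¹ * ∑ y ∈ box (0 : Zd 3) ⌊s * R⌋, ∑ μ : Fin 3, ‖V (P (y + unitVec μ)) - V (P y)‖ ^ 2 ≤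
        (∫ x in {x : EuclideanSpace ℝ (Fin 3) | ∀ i : Fin 3, |x i| < s'},
          ∑ i : Fin 3, ‖fderiv ℝ V x (EuclideanSpace.single i (1:ℝ))‖ ^ 2) + η := by
  classical
  -- names
  set C1 : Set (EuclideanSpace ℝ (Fin 3)) := {x | ∀ i : Fin 3, |x i| < 1} with hC1
  set Cs : Set (EuclideanSpace ℝ (Fin 3)) := {x | ∀ i : Fin 3, |x i| < s'} with hCs
  set K : Set (EuclideanSpace ℝ (Fin 3)) := {x | ∀ i : Fin 3, |x i| ≤ s'} with hK
  set D : EuclideanSpace ℝ (Fin 3) → (EuclideanSpace ℝ (Fin 3) →L[ℝ] EuclideanSpace ℝ (Fin 4)) := fderiv ℝ V with hDdef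
  set dens : EuclideanSpace ℝ (Fin 3) → ℝ := fun x => ∑ i : Fin 3, ‖D x (EuclideanSpace.single i (1:ℝ))‖ ^ 2 with hdens
  set I : ℝ := ∫ x in Cs, dens x with hI
  have hI0 : 0 ≤ I := setIntegral_nonneg (isOpen_absCube s').measurableSet fun x _ => by positivity
  have hCsC1 : Cs ⊆ C1 := fun x hx i => (hx i).trans hs'1
  have hKC1 : K ⊆ C1 := fun x hx i => (hx i).trans_lt hs'1
  have hCsK : Cs ⊆ K := fun x hx i => (hx i).le
  -- uniform continuity of the derivative on the compact cube `K`
  have hDcont : ContinuousOn D C1 := hV.continuousOn_fderiv_of_isOpen (isOpen_absCube 1) le_rfl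
  have hKc : IsCompact K := isCompact_absCubeClosed (by linarith)
  have hDunif : UniformContinuousOn D K := hKc.uniformContinuousOn_of_continuous (hDcont.mono hKC1)
  -- constants
  set θ : ℝ := η / (2 * (I + 1)) with hθ
  have hθ0 : 0 < θ := div_pos hη (by linarith)
  have hθinv : 0 ≤ θ⁻¹ := inv_nonneg.mpr hθ0.le
  have hdens0 : ∀ x, 0 ≤ dens x := fun x => by
    simp only [hdens]; exact Finset.sum_nonneg fun i _ => sq_nonneg _
  have hθI : θ * I ≤ η / 2 := by
    rw [hθ]
    have : η / (2 * (I + 1)) * I = η / 2 * (I / (I + 1)) := by field_simp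
    rw [this]
    have hfrac : I / (I + 1) ≤ 1 := by rw [div_le_one (by linarith)]; linarith
    nlinarith
  have hcoef : 0 ≤ 3 * (1 + θ⁻¹) * (2 * s') ^ 3 :=
    mul_nonneg (mul_nonneg (by norm_num) (by linarith)) (pow_nonneg (by linarith) 3)
  set M : ℝ := 3 * (1 + θ⁻¹) * (2 * s') ^ 3 + 1 with hM
  have hM0 : 0 < M := by linarith
  set ω : ℝ := min 1 (η / (2 * M)) with hω
  have hω0 : 0 < ω := lt_min one_pos (div_pos hη (by linarith))
  have hω1 : ω ≤ 1 := min_le_left _ _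
  have hωM : 3 * (1 + θ⁻¹) * (2 * s') ^ 3 * ω ^ 2 ≤ η / 2 := by
    have h1 : ω ^ 2 ≤ ω := by nlinarith
    have h2 : ω ≤ η / (2 * M) := min_le_right _ _
    have h3 : 3 * (1 + θ⁻¹) * (2 * s') ^ 3 ≤ M := by rw [hM]; linarith
    calc 3 * (1 + θ⁻¹) * (2 * s') ^ 3 * ω ^ 2 ≤ M * ω := mul_le_mul h3 h1 (sq_nonneg _) hM0.le
      _ ≤ M * (η / (2 * M)) := mul_le_mul_of_nonneg_left h2 hM0.le
      _ = η / 2 := by field_simp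
  -- modulus of continuity
  obtain ⟨δ, hδ0, hδ⟩ := Metric.uniformContinuousOn_iff.mp hDunif ω hω0
  -- the threshold
  obtain ⟨R₁, hR₁⟩ := exists_nat_gt (2 / δ + (s' - s)⁻¹)
  refine ⟨R₁ + 1, fun R hR P hP => ?_⟩
  have hRpos : 0 < R := by omega
  have hR0 : (0 : ℝ) < R := by exact_mod_cast hRpos
  have hRge : 2 / δ + (s' - s)⁻¹ < R := by
    have : (R₁ : ℝ) + 1 ≤ R := by exact_mod_cast hR
    linarith
  have hRδ : 2 / (R : ℝ) < δ := by
    rw [div_lt_iff₀ hR0]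
    have : 2 / δ < R := by linarith [inv_nonneg.mpr (by linarith : (0:ℝ) ≤ s' - s)]
    rw [div_lt_iff₀ hδ0] at this; linarith
  have hRs : (R : ℝ)⁻¹ < s' - s := by
    have h1 : (s' - s)⁻¹ < R := by linarith [div_nonneg (by norm_num : (0:ℝ) ≤ 2) hδ0.le]
    rw [inv_lt_comm₀ (by linarith) hR0] at h1; exact h1
  -- per-cell pointwise bound: for `y` in the box and `x₀` in its open cell,
  -- `R² Σ_μ ‖δ_μ v(y)‖² ≤ (1+θ)·dens x₀ + 3(1+θ⁻¹)ω²`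
  have hcellpt : ∀ y ∈ box (0 : Zd 3) ⌊s * R⌋, ∀ x₀ : EuclideanSpace ℝ (Fin 3),
      (∀ i, (y i : ℝ) / R < x₀ i ∧ x₀ i < ((y i : ℝ) + 1) / R) →
      (R : ℝ) ^ 2 * ∑ μ : Fin 3, ‖V (P (y + unitVec μ)) - V (P y)‖ ^ 2 ≤
        (1 + θ) * dens x₀ + 3 * ((1 + θ⁻¹) * ω ^ 2) := by
    intro y hy x₀ hx₀
    -- the closed cell is convex, inside `C1`, of diameter `< δ`
    set S : Set (EuclideanSpace ℝ (Fin 3)) := {x | ∀ i, (y i : ℝ) / R ≤ x i ∧ x i ≤ ((y i : ℝ) + 1) / R} with hSdef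
    have hSK : S ⊆ K := fun x hx => hCsK (closedCell_subset_absCube hRpos hRs hy hx)
    have hSC1 : S ⊆ C1 := fun x hx => hKC1 (hSK hx)
    have hSconv : Convex ℝ S := by
      have : S = ⋂ i : Fin 3, {x : EuclideanSpace ℝ (Fin 3) | (y i : ℝ) / R ≤ x i ∧ x i ≤ ((y i : ℝ) + 1) / R} := by
        ext x; simp [hSdef]
      rw [this]
      refine convex_iInter fun i => ?_
      have : {x : EuclideanSpace ℝ (Fin 3) | (y i : ℝ) / R ≤ x i ∧ x i ≤ ((y i : ℝ) + 1) / R} =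
          (EuclideanSpace.proj i : EuclideanSpace ℝ (Fin 3) →L[ℝ] ℝ) ⁻¹' Icc ((y i : ℝ) / R) (((y i : ℝ) + 1) / R) := by
        ext x; simp [Set.mem_Icc]
      rw [this]
      exact (convex_Icc _ _).linear_preimage (EuclideanSpace.proj i).toLinearMap
    have hx₀S : x₀ ∈ S := fun i => ⟨(hx₀ i).1.le, (hx₀ i).2.le⟩
    have hDS : ∀ z ∈ S, HasFDerivWithinAt V (D z) S z := fun z hz =>
      (((hV.differentiableOn one_ne_zero).differentiableAt ((isOpen_absCube 1).mem_nhds (hSC1 hz))).hasFDerivAt).hasFDerivWithinAt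
    have hωS : ∀ z ∈ S, ‖D z - D x₀‖ ≤ ω := by
      intro z hz
      have hd : dist z x₀ < δ := lt_of_le_of_lt (dist_le_of_mem_closedCell hRpos hz hx₀S) hRδ
      have := hδ z (hSK hz) x₀ (hSK hx₀S) hd
      rw [dist_eq_norm] at this
      exact this.le
    -- the two bond endpoints
    have hPy : P y ∈ S := by
      intro i; rw [hP]
      constructor
      · exact le_rfl
      · exact div_le_div_of_nonneg_right (by linarith) hR0.le
    have hPstep : ∀ μ : Fin 3, P (y + unitVec μ) = P y + (R : ℝ)⁻¹ • EuclideanSpace.single μ (1:ℝ) := by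
      intro μ
      ext i
      rw [hP]
      simp only [PiLp.add_apply, PiLp.smul_apply, PiLp.single_apply, smul_eq_mul, hP, Pi.add_apply]
      by_cases hi : i = μ
      · subst hi; simp [div_eq_mul_inv]; ring
      · simp [hi]
    have hPy' : ∀ μ : Fin 3, P y + (R : ℝ)⁻¹ • EuclideanSpace.single μ (1:ℝ) ∈ S := by
      intro μ i
      simp only [PiLp.add_apply, PiLp.smul_apply, PiLp.single_apply, smul_eq_mul, hP]
      by_cases hi : i = μ
      · subst hi; simp only [if_true, mul_one]
        constructor
        · linarith [inv_nonneg.mpr hR0.le]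
        · rw [add_div, one_div]
      · simp only [hi, if_false, mul_zero, add_zero]
        exact ⟨le_rfl, div_le_div_of_nonneg_right (by linarith) hR0.le⟩
    -- bond by bond
    have hbond : ∀ μ : Fin 3, ‖V (P (y + unitVec μ)) - V (P y)‖ ^ 2 ≤
        ((R : ℝ)⁻¹) ^ 2 * ((1 + θ) * ‖D x₀ (EuclideanSpace.single μ (1:ℝ))‖ ^ 2 + (1 + θ⁻¹) * ω ^ 2) := by
      intro μ
      have h1 := norm_sample_sub_le V D hSconv hDS x₀ hωS (P y) (EuclideanSpace.single μ (1:ℝ))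
        (by rw [PiLp.norm_single, norm_one]) hR0 hPy (hPy' μ)
      rw [← hPstep μ] at h1
      have h0 : 0 ≤ ‖V (P (y + unitVec μ)) - V (P y)‖ := norm_nonneg _
      calc ‖V (P (y + unitVec μ)) - V (P y)‖ ^ 2 ≤ ((R : ℝ)⁻¹ * (‖D x₀ (EuclideanSpace.single μ (1:ℝ))‖ + ω)) ^ 2 :=
            pow_le_pow_left₀ h0 h1 2
        _ = ((R : ℝ)⁻¹) ^ 2 * (‖D x₀ (EuclideanSpace.single μ (1:ℝ))‖ + ω) ^ 2 := by ring
        _ ≤ ((R : ℝ)⁻¹) ^ 2 * ((1 + θ) * ‖D x₀ (EuclideanSpace.single μ (1:ℝ))‖ ^ 2 + (1 + θ⁻¹) * ω ^ 2) :=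
            mul_le_mul_of_nonneg_left (sq_add_le_weighted hθ0) (by positivity)
    have hsum := Finset.sum_le_sum fun μ (_ : μ ∈ (Finset.univ : Finset (Fin 3))) => hbond μ
    have hRR : (R : ℝ) ^ 2 * ((R : ℝ)⁻¹) ^ 2 = 1 := by field_simp
    calc (R : ℝ) ^ 2 * ∑ μ : Fin 3, ‖V (P (y + unitVec μ)) - V (P y)‖ ^ 2
        ≤ (R : ℝ) ^ 2 * ∑ μ : Fin 3, ((R : ℝ)⁻¹) ^ 2 *
            ((1 + θ) * ‖D x₀ (EuclideanSpace.single μ (1:ℝ))‖ ^ 2 + (1 + θ⁻¹) * ω ^ 2) :=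
          mul_le_mul_of_nonneg_left hsum (by positivity)
      _ = (1 + θ) * dens x₀ + 3 * ((1 + θ⁻¹) * ω ^ 2) := by
          rw [hdens, ← Finset.mul_sum, ← mul_assoc, hRR, one_mul, Finset.sum_add_distrib, Finset.mul_sum]
          simp
  -- integrate the pointwise bound over each cell
  set g : EuclideanSpace ℝ (Fin 3) → ℝ := fun x => (1 + θ) * dens x + 3 * ((1 + θ⁻¹) * ω ^ 2) with hg
  have hg0 : ∀ x, 0 ≤ g x := fun x => by
    simp only [hg]
    exact add_nonneg (mul_nonneg (by linarith) (hdens0 x)) (mul_nonneg (by norm_num) (mul_nonneg (by linarith) (sq_nonneg _)))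
  have hdensint : IntegrableOn dens Cs volume := by simpa [hdens, hDdef] using hint
  have hCsfin : volume Cs < ⊤ := by
    have h := volume_real_absCube (t := s') (by linarith)
    by_contra htop
    rw [not_lt, top_le_iff] at htop
    rw [htop, ENNReal.toReal_top] at h
    have : (0:ℝ) < 8 * s' ^ 3 := by have := pow_pos (show (0:ℝ) < s' by linarith) 3; linarith
    linarith
  have hgint : IntegrableOn g Cs volume :=
    (hdensint.const_mul (1 + θ)).add (integrableOn_const hCsfin.ne)
  have hcellint : ∀ y ∈ box (0 : Zd 3) ⌊s * R⌋,
      (R : ℝ)⁻¹ * ∑ μ : Fin 3, ‖V (P (y + unitVec μ)) - V (P y)‖ ^ 2 ≤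
        ∫ x in {x : EuclideanSpace ℝ (Fin 3) | ∀ i, (y i : ℝ) / R < x i ∧ x i < ((y i : ℝ) + 1) / R}, g x := by
    intro y hy
    set cell : Set (EuclideanSpace ℝ (Fin 3)) := {x | ∀ i, (y i : ℝ) / R < x i ∧ x i < ((y i : ℝ) + 1) / R} with hcell
    have hcellCs : cell ⊆ Cs := cell_subset_absCube hRpos hRs hy
    have hvol : (volume cell).toReal = ((R : ℝ)⁻¹) ^ 3 := volume_real_cell R hRpos y
    have hvolfin : volume cell ≠ ⊤ := ne_top_of_le_ne_top hCsfin.ne (measure_mono hcellCs)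
    set A : ℝ := (R : ℝ) ^ 2 * ∑ μ : Fin 3, ‖V (P (y + unitVec μ)) - V (P y)‖ ^ 2 with hA
    have hconst : ∫ _ in cell, A = ((R : ℝ)⁻¹) ^ 3 * A := by
      rw [setIntegral_const, smul_eq_mul, Measure.real, hvol]
    have hmono : ∫ _ in cell, A ≤ ∫ x in cell, g x := by
      refine setIntegral_mono_on (integrableOn_const hvolfin) (hgint.mono_set hcellCs) (measurableSet_cell _ _) ?_
      intro x hx
      exact hcellpt y hy x hx
    calc (R : ℝ)⁻¹ * ∑ μ : Fin 3, ‖V (P (y + unitVec μ)) - V (P y)‖ ^ 2 = ((R : ℝ)⁻¹) ^ 3 * A := by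
          rw [hA]; field_simp
      _ = ∫ _ in cell, A := hconst.symm
      _ ≤ ∫ x in cell, g x := hmono
  -- sum over the (pairwise disjoint) cells and compare with the cube
  have hdisj : Set.Pairwise (↑(box (0 : Zd 3) ⌊s * R⌋))
      (Function.onFun Disjoint fun y : Zd 3 => {x : EuclideanSpace ℝ (Fin 3) | ∀ i, (y i : ℝ) / R < x i ∧ x i < ((y i : ℝ) + 1) / R}) :=
    fun y _ y' _ hne => disjoint_cell hRpos hne
  have hunion := integral_biUnion_finset (box (0 : Zd 3) ⌊s * R⌋) (μ := volume) (f := g)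
    (fun y _ => measurableSet_cell _ _) hdisj (fun y hy => hgint.mono_set (cell_subset_absCube hRpos hRs hy))
  have hUsub : (⋃ y ∈ box (0 : Zd 3) ⌊s * R⌋,
      {x : EuclideanSpace ℝ (Fin 3) | ∀ i, (y i : ℝ) / R < x i ∧ x i < ((y i : ℝ) + 1) / R}) ⊆ Cs := by
    intro x hx
    simp only [Set.mem_iUnion] at hx
    obtain ⟨y, hy, hxy⟩ := hx
    exact cell_subset_absCube hRpos hRs hy hxy
  calc (R : ℝ)⁻¹ * ∑ y ∈ box (0 : Zd 3) ⌊s * R⌋, ∑ μ : Fin 3, ‖V (P (y + unitVec μ)) - V (P y)‖ ^ 2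
      = ∑ y ∈ box (0 : Zd 3) ⌊s * R⌋, (R : ℝ)⁻¹ * ∑ μ : Fin 3, ‖V (P (y + unitVec μ)) - V (P y)‖ ^ 2 := Finset.mul_sum _ _ _
    _ ≤ ∑ y ∈ box (0 : Zd 3) ⌊s * R⌋,
          ∫ x in {x : EuclideanSpace ℝ (Fin 3) | ∀ i, (y i : ℝ) / R < x i ∧ x i < ((y i : ℝ) + 1) / R}, g x :=
        Finset.sum_le_sum hcellint
    _ = ∫ x in ⋃ y ∈ box (0 : Zd 3) ⌊s * R⌋,
          {x : EuclideanSpace ℝ (Fin 3) | ∀ i, (y i : ℝ) / R < x i ∧ x i < ((y i : ℝ) + 1) / R}, g x := hunion.symm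
    _ ≤ ∫ x in Cs, g x := setIntegral_mono_set hgint (Filter.Eventually.of_forall hg0) (ae_of_all _ fun x hx => hUsub hx)
    _ = (1 + θ) * I + (volume Cs).toReal * (3 * ((1 + θ⁻¹) * ω ^ 2)) := by
        rw [hg, integral_add (hdensint.const_mul _) (integrableOn_const hCsfin.ne), integral_const_mul, setIntegral_const,
          smul_eq_mul, Measure.real]
    _ = I + (θ * I + 3 * (1 + θ⁻¹) * (2 * s') ^ 3 * ω ^ 2) := by
        rw [volume_real_absCube (by linarith)]; ring
    _ ≤ I + η := by linarith [hθI, hωM]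

end Summit.QuantumFields.YangMills.Theorems.PoincareLipschitzSamplingConsistency

end
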